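import Summits.QuantumFields.YangMills.Theses.RandomConstraintAnnealing
import Summits.QuantumFields.YangMills.Theses.EquipartitionCriticality
import Summits.QuantumFields.YangMills.Theorems.EquipartitionCriticalityFreeEnergyLogCoefficient
import Summits.QuantumFields.YangMills.Theorems.EquipartitionCriticalityEquipartitionPinsProbe
import Summits.QuantumFields.YangMills.Theorems.EquipartitionCriticalityRPProbeCriticality
import HarnessLib

/-!
# Line `hub_redirect` — crux `LatticeGapToClay` (stmt-QuantumFields-8718, route `RandomConstraintAnnealing`)

Crux (fixed, by name): `Summit.QuantumFields.YangMills.Theses.RandomConstraintAnnealing.LatticeGapToClay :=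
TubeGapLatticeLeg → YangMills` — the UV / Osterwalder–Schrader legs of the Clay problem GIVEN the
volume-uniform lattice gap at all weak couplings (the route's target `TubeGapLatticeLeg`, delivered by the
Edwards–Sokal cruxes 8716/8717).

Strategist's line (crux-strategist unit `cstrat-stmt-QuantumFields-8718-r1`, 2026-08-17; registered as the
BC2-REDIRECT decomposition of the crux).  Two stubs, kernel-checked composition:

* `stub_weakCouplingCriticality` — CRITICALITY AT WEAK COUPLING (Chatterjee's Problem 5.1(b), all-observable
  odd-torus form = hypothesis (2) of the hub): every admissible volume-uniform exponential clustering rate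
  `m(β)` of 4-D Wilson lattice Yang–Mills with compact simple `G` in a faithful representation tends to `0`
  as `β → ∞`.  CLOSED: it is PROVED below from the three landed theorems of route `EquipartitionCriticality`
  (`freeEnergyLogCoefficient_proof` stmt-8759, `EquipartitionPinsProbe_proof` stmt-8760,
  `rpProbeCriticality_proof` stmt-8763) — no `sorry`.
* `stub_criticalContinuumLimit` — THE SHARED HUB BY NAME, `EquipartitionCriticality.CriticalContinuumLimit`
  (item stmt-QuantumFields-15940 = `DirichletWindow.WeakCouplingContinuumLimit`): gap-at-large-β + criticality
  ⇒ the `G`-clause of `YangMills`.  OPEN; its plan is its own registered birth skeleton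
  `Cruxes/WeakCouplingContinuumLimit/Lines/birth.lean` (stubs `stub_saturatedCriticalRate` — lattice infrared
  saturation of the admissible rate by the plaquette; `stub_continuumLimitOS` — one-field OS continuum limit
  riding the critical rate, alive and gapped; `stub_nonGaussianLimit` — interaction) and the older line
  `Cruxes/CriticalContinuumLimit/Lines/Sketch.lean`.

Composition `LatticeGapToClay_of : stub₁ → stub₂ → LatticeGapToClay` is pure logic (the body of
`TubeGapLatticeLeg` is hypothesis (1) of the hub for each `G` up to regrouping the binders
`∀ S, S₀ β ≤ S → ∀ n, n ≤ S` vs `∀ S n, S₀ β ≤ S → n ≤ S`; stub 1 is hypothesis (2)); `LatticeGapToClay_proof`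
is the registered form (stubs BY NAME).  Why it dodges every STUCK goal of the sibling UV legs: nothing is
re-derived here — the crux is shown to be a COROLLARY of the hub, so every cycle spent on 8718 directly is a
cycle better spent on 15940's stubs; the route's distinctive content stays in its Edwards–Sokal cruxes.

Disproof used: none exists for this crux (`ledger crux ls stmt-QuantumFields-8718`: no workfiles before this
line; no `Theorems/…/LatticeGapToClay/Negative/*`).  Sibling negatives honoured by typing: GapToContinuum D2/D3b
(`Cruxes/GapToContinuum/STRATEGY-CENSUS.md`: universal-scheme gap inheritance is misstated) — no universal
`HasLatticeMassGap → T.HasMassGap` statement appears; the hub's scheme is existential.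
-/

noncomputable section

namespace Summit.QuantumFields.YangMills.Cruxes.LatticeGapToClay.HubRedirect

open Filter
open Literature.MathematicalPhysics.QuantumFieldTheory
open Summit.QuantumFields.YangMills.Theses

/-- The crux this line closes (by name). -/
example : Prop := RandomConstraintAnnealing.LatticeGapToClay

/-! ## Stubs -/

/-- **stub_weakCouplingCriticality** (CLOSED — proved here from landed tree theorems; Chatterjee's Problem
5.1(b)): for every compact simple `G`, faithful `r`, threshold `β₁` and rate function `m`, if `m(β) > 0` is
an admissible volume-uniform clustering rate of all pairs of gauge-invariant local observables on the odd
tori at every `β ≥ β₁`, then `∀ m₀ > 0, ∀ᶠ β, m β < m₀`. -/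
theorem stub_weakCouplingCriticality :
    ∀ (G : Type) [Group G] [TopologicalSpace G] [IsTopologicalGroup G] [CompactSpace G],
      IsCompactSimpleLieGroup G →
        letI : MeasurableSpace G := borel G
        haveI : BorelSpace G := ⟨rfl⟩
        ∀ r : LatticeRep G, ∀ (β₁ : ℝ) (m : ℝ → ℝ),
          (∀ β : ℝ, β₁ ≤ β → 0 < m β ∧ (∃ S₀ : ℕ, ∀ A B : YMSpecies G, ∃ C : ℝ, ∀ S n : ℕ,
              S₀ ≤ S → n ≤ S →
                |latticeConnectedCorr r.ρ β (2 * S + 1) A.F B.F n| ≤ C * Real.exp (-(m β * n)))) →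
            ∀ m₀ : ℝ, 0 < m₀ → ∀ᶠ β : ℝ in Filter.atTop, m β < m₀ := by
  intro G _ _ _ _ hG r
  exact Theorems.rpProbeCriticality_proof G hG r
    (Theorems.EquipartitionPinsProbe_proof G hG r (Theorems.freeEnergyLogCoefficient_proof G hG r))

/-- **stub_criticalContinuumLimit** (OPEN — the shared hub BY NAME, item stmt-QuantumFields-15940; plan:
`Cruxes/WeakCouplingContinuumLimit/Lines/birth.lean`, 3 stubs): gap-at-large-β (hyp 1) and criticality
(hyp 2) give, for every compact simple `G`, a weak-coupling scheme and OS data with the `YangMills` clauses. -/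
theorem stub_criticalContinuumLimit : EquipartitionCriticality.CriticalContinuumLimit := by
  sorry

/-! ## Composition -/

/-- **The two stub STATEMENTS imply the crux** (pure logic; no reference to the stubs' proofs). -/
theorem LatticeGapToClay_of
    (hcrit : ∀ (G : Type) [Group G] [TopologicalSpace G] [IsTopologicalGroup G] [CompactSpace G],
      IsCompactSimpleLieGroup G →
        letI : MeasurableSpace G := borel G
        haveI : BorelSpace G := ⟨rfl⟩
        ∀ r : LatticeRep G, ∀ (β₁ : ℝ) (m : ℝ → ℝ),
          (∀ β : ℝ, β₁ ≤ β → 0 < m β ∧ (∃ S₀ : ℕ, ∀ A B : YMSpecies G, ∃ C : ℝ, ∀ S n : ℕ,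
              S₀ ≤ S → n ≤ S →
                |latticeConnectedCorr r.ρ β (2 * S + 1) A.F B.F n| ≤ C * Real.exp (-(m β * n)))) →
            ∀ m₀ : ℝ, 0 < m₀ → ∀ᶠ β : ℝ in Filter.atTop, m β < m₀)
    (hhub : EquipartitionCriticality.CriticalContinuumLimit) :
    RandomConstraintAnnealing.LatticeGapToClay := by
  intro hX G _ _ _ _ hG
  refine hhub G hG (fun r => ?_) (hcrit G hG)
  obtain ⟨β₀, m, S₀, hm, hAB⟩ := hX G hG r
  refine ⟨β₀, m, S₀, hm, fun A B => ?_⟩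
  obtain ⟨C, hC⟩ := hAB A B
  exact ⟨C, fun β hβ S n hS hn => hC β hβ S hS n hn⟩

/-- **Registered form**: the line closes the crux modulo its stubs BY NAME (only `stub_criticalContinuumLimit`
carries a `sorry`). -/
theorem LatticeGapToClay_proof : RandomConstraintAnnealing.LatticeGapToClay :=
  LatticeGapToClay_of stub_weakCouplingCriticality stub_criticalContinuumLimit

/-- Bookkeeping recorded for the re-audit: the route's target and the hub's hypothesis (1) coincide —
`EquipartitionCriticality.LatticeGapLargeBeta ↔ RandomConstraintAnnealing.TubeGapLatticeLeg`. -/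
theorem latticeGapLargeBeta_iff_tubeGapLatticeLeg :
    EquipartitionCriticality.LatticeGapLargeBeta ↔ RandomConstraintAnnealing.TubeGapLatticeLeg := by
  constructor
  · intro h G _ _ _ _ hG r
    obtain ⟨β₁, m, S₀, hm, hAB⟩ := h G hG r
    refine ⟨β₁, m, S₀, hm, fun A B => ?_⟩
    obtain ⟨C, hC⟩ := hAB A B
    exact ⟨C, fun β hβ S hS n hn => hC β hβ S n hS hn⟩
  · intro h G _ _ _ _ hG r
    obtain ⟨β₀, m, S₀, hm, hAB⟩ := h G hG r
    refine ⟨β₀, m, S₀, hm, fun A B => ?_⟩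
    obtain ⟨C, hC⟩ := hAB A B
    exact ⟨C, fun β hβ S n hS hn => hC β hβ S hS n hn⟩

end Summit.QuantumFields.YangMills.Cruxes.LatticeGapToClay.HubRedirect

end
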